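import Summits.ResolutionOfSingularities.ResolutionOfSingularities.Theorems.EquisingularLiftEquisingularLiftNatNoseTowerSevenOfFact
import Summits.ResolutionOfSingularities.ResolutionOfSingularities.Theorems.EquisingularLiftEquisingularLiftNatDefNoseTowerResolutionOfHsub
import Summits.ResolutionOfSingularities.ResolutionOfSingularities.Theorems.EquisingularLiftEquisingularLiftNatTowerRoundFourDefs
import HarnessLib

/-!
# [OURS · L1 W4.5(b) · EL♮(3)] THE REGISTERED PLUMBING RUNG `stub_elnat_defNoseTowerResolutionThree` (DEF-NOSE-TOWER₇ at n = 3) — PROVED modulo NOTHING but its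
# own hypothesis `EmbeddedCurveLiftFact` (crux `EquisingularLiftNatThree` = stmt-ResolutionOfSingularities-20148, parent EL♮ stmt-…-20038; TWENTY-FIRST / TWENTY-SECOND
# registration, CHILD skeleton v27/v28 of res-L1-w45b-lead-2 g4; statement = `L/res-L1-w45b-lead-2/TARGET-DEFNOSETOWER7-THREE.sig.txt` sha16 62cc1fd080be48f5 VERBATIM)

res-L1-w45b-stub-2 g9 (OWNER, desk DEAL at the TWENTIETH STATUS). OURS; NOT a statement of any manuscript; AI-written, weaker than expert review. No `sorry`;
standard axioms; DEF-FREE; `--supports stmt-ResolutionOfSingularities-20148` (stub credit BY NAME).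

PROOF = INST ∘ ENGINE: `stub_elnat_defNoseTowerResolution_of_hsub₇` (…NatDefNoseTowerResolutionOfHsub p597239, at `n := 3`) fed by the engine
`hsub_reachNoseTower_seven_of_fact` (…NatNoseTowerSevenOfFact) with (T-k) `hFact := hF k O θ hθ P q` — the registered NEED-FACT `EmbeddedCurveLiftFact`
(…NatTowerRoundFourDefs p594791; itself DERIVED in the skeleton from `EmbeddedLiftFact` by res-type-027's p597023) instantiated over the running base.
-/

set_option linter.dupNamespace false -- mandated namespace `Summit.<Summit>.<Problem>` of this single-conjunct summit

namespace Summit.ResolutionOfSingularities.ResolutionOfSingularities.Cruxes.EquisingularLiftNat.Sections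

/-- **DEF-NOSE-TOWER₇ at n = 3 — the registered plumbing rung `stub_elnat_defNoseTowerResolutionThree`** (statement VERBATIM the TWENTY-FIRST / TWENTY-SECOND registered text):
an integral closed `H ↪ ℙ³_k` (char `p`, `k` algebraically closed, `ι.ker` locally principal) whose `ReachNoseTower₇` witness exists — a nose `Z` of the liftable
class₂ inside `ι(H)`, infinite, not all of `ι(H)`, with 1-dimensional closed-point stalks of `Z̃`, and a tower from the nose blow-up closed under regular/ramified
in-carrier point steps and `TowerRound₅` rounds reaching a stage whose running curve has regular reduced closure — admits the W4.5(b) conclusion (a DVR `O` of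
characteristic 0 onto `k` and an embedded resolution datum over `Proj O[x₀…x₃]`), GIVEN (T-k) `EmbeddedCurveLiftFact`. [cite: GortzWedhorn2020, Prop. 13.91 and (13.19)]
[cite: Liu2002, §8.1 and Thm. 8.1.19] [OURS · L1 W4.5b · stub of CHILD skeleton v28]; NOT a statement of the manuscript; AI-written, weaker than expert review. -/
theorem stub_elnat_defNoseTowerResolutionThree (p : ℕ) : EmbeddedCurveLiftFact → p.Prime → ∀ (k : Type) [Field k] [CharP k p] [IsAlgClosed k] (H : AlgebraicGeometry.Scheme.{0}) (ι : H ⟶ (Literature.AlgebraicGeometry.Motives.projectiveSpace 3 k).left), AlgebraicGeometry.IsClosedImmersion ι → AlgebraicGeometry.IsIntegral H → (∀ y : (Literature.AlgebraicGeometry.Motives.projectiveSpace 3 k).left, ∃ U : (Literature.AlgebraicGeometry.Motives.projectiveSpace 3 k).left.affineOpens, y ∈ (U : (Literature.AlgebraicGeometry.Motives.projectiveSpace 3 k).left.Opens) ∧ (ι.ker.ideal U).IsPrincipal) → (ReachNoseTower₇ k 3 H ι) → ∃ (O : Type) (_ : CommRing O) (_ : IsDomain O) (_ : IsDiscreteValuationRing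 O) (_ : CharZero O) (π : O →+* k), Function.Surjective π ∧ (letI := MvPolynomial.gradedAlgebra (σ := Fin (3 + 1)) (R := O); letI := MvPolynomial.gradedAlgebra (σ := Fin (3 + 1)) (R := k); ∀ (φ : MvPolynomial.homogeneousSubmodule (Fin (3 + 1)) O →+*ᵍ MvPolynomial.homogeneousSubmodule (Fin (3 + 1)) k) (hφ' : HomogeneousIdeal.irrelevant (MvPolynomial.homogeneousSubmodule (Fin (3 + 1)) k) ≤ (HomogeneousIdeal.irrelevant (MvPolynomial.homogeneousSubmodule (Fin (3 + 1)) O)).map φ), (∀ s, φ s = MvPolynomial.map π s) → ∀ Y : Set (AlgebraicGeometry.Proj (MvPolynomial.homogeneousSubmodule (Fin (3 + 1)) O)), Y = Set.range (CategoryTheory.CategoryStruct.comp ι (AlgebraicGeometry.Proj.map φ hφ') : H ⟶ (AlgebraicGeometry.Proj (MvPolynomial.homogeneousSubmodule (Fin (3 + 1)) O))) → ∃ (P' : AlgebraicGeometry.Scheme.{0}) (σ : P' ⟶ (AlgebraicGeometry.Proj (MvPolynomial.homogeneousSubmodule (Fin (3 + 1)) O))) (S' : Set P'), (∀ Q : (∀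 X' : AlgebraicGeometry.Scheme.{0}, (X' ⟶ (AlgebraicGeometry.Proj (MvPolynomial.homogeneousSubmodule (Fin (3 + 1)) O))) → Set X' → Prop), Q (AlgebraicGeometry.Proj (MvPolynomial.homogeneousSubmodule (Fin (3 + 1)) O)) (CategoryTheory.CategoryStruct.id _) Y → (∀ (X' X'' : AlgebraicGeometry.Scheme.{0}) (σ' : X' ⟶ (AlgebraicGeometry.Proj (MvPolynomial.homogeneousSubmodule (Fin (3 + 1)) O))) (Y' : Set X') (C : X'.IdealSheafData) (τ : X'' ⟶ X'), Q X' σ' Y' → Literature.AlgebraicGeometry.Resolution.IsBlowup τ C → Literature.AlgebraicGeometry.Resolution.Scheme.IsRegular C.subscheme → AlgebraicGeometry.Flat (CategoryTheory.CategoryStruct.comp C.subschemeι (CategoryTheory.CategoryStruct.comp σ' (CategoryTheory.CategoryStruct.comp (AlgebraicGeometry.Proj.toSpecZero (MvPolynomial.homogeneousSubmodule (Fin (3 + 1)) O)) (AlgebraicGeometry.Spec.map (CommRingCat.ofHom (algebraMap O (MvPolynomial.homogeneousSubmodule (Fin (3 + 1)) O 0))))))) → σ' '' (C.support : Set X') ⊆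 {x | ¬ IsGenericPoint x Y} → (C.support : Set X') ∩ (CategoryTheory.CategoryStruct.comp σ' (CategoryTheory.CategoryStruct.comp (AlgebraicGeometry.Proj.toSpecZero (MvPolynomial.homogeneousSubmodule (Fin (3 + 1)) O)) (AlgebraicGeometry.Spec.map (CommRingCat.ofHom (algebraMap O (MvPolynomial.homogeneousSubmodule (Fin (3 + 1)) O 0)))))) ⁻¹' {IsLocalRing.closedPoint O} ⊆ Y' → Q X'' (CategoryTheory.CategoryStruct.comp τ σ') (closure (τ ⁻¹' (Y' \ (C.support : Set X'))))) → Q P' σ S') ∧ Literature.AlgebraicGeometry.Resolution.Scheme.IsRegular (AlgebraicGeometry.Scheme.IdealSheafData.vanishingIdeal (⟨closure S', isClosed_closure⟩ : TopologicalSpace.Closeds P')).subscheme) := by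
  intro hF hp k _ _ _ H ι hι hH hloc hreach
  exact stub_elnat_defNoseTowerResolution_of_hsub₇ p hp k 3 H ι hι hH hloc
    (fun O _ _ _ _ _ θ hθ P q Y Ch hChStep hChSplit hYsp hYirr hYcl hPint hPnoeth hPreg hqprop hqsm X' σ' S' hCh' hX'int hX'noeth hX'reg hX'dom F₁ hF₁ j t hsq T₁ hT₁cl hT₁irr hjT₁ Z hZ hZT₁ hT₁Z hZinf hZdim C hCsm hCreg hCfl hCj hCoff X₁ τ₁ hτ₁ hX₁int hX₁noeth hX₁reg hX₁dom F₂ hF₂ υ hυ j₂ t₂ hsq₂ hcomm hexc hirr₂ hCh₁ =>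
      hsub_reachNoseTower_seven_of_fact k O θ hθ P q Y Ch hChStep hChSplit hYsp hYirr hYcl hPint hPnoeth hPreg hqprop hqsm X' σ' S' hCh' hX'int hX'noeth hX'reg hX'dom F₁ hF₁ j t hsq T₁ hT₁cl hT₁irr hjT₁ Z hZ hZT₁ hT₁Z hZinf hZdim C hCsm hCreg hCfl hCj hCoff X₁ τ₁ hτ₁ hX₁int hX₁noeth hX₁reg hX₁dom F₂ hF₂ υ hυ j₂ t₂ hsq₂ hcomm hexc hirr₂ hCh₁ (hF k O θ hθ P q))
    hreach

end Summit.ResolutionOfSingularities.ResolutionOfSingularities.Cruxes.EquisingularLiftNat.Sections
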